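import Summits.FinalStateConjecture.FinalStateConjecture.Theorems.NearExtremalKappaCapture.Negative.ExtremalGerm
import Summits.FinalStateConjecture.FinalStateConjecture.Theorems.NearExtremalKappaCapture.Negative.TruncationTraps

/-!
# `NearExtremalKappaCapture` (crux stmt-FinalStateConjecture-10606, route PhaseMixingCapture):
# drift families — the lower edge of the modulus exponent (negative-side support, cdisprove
# seat, cycle 3)

Companion to `ExponentMonotonicity.lean` (p73006: `CaptureWith`, `captureWith_mono`),
`TruncationTraps.lean` (p76436: `spin_of_kappaSq`) and `ExtremalGerm.lean` (p77058:
`LinearCaptureWith`, `captureWith_of_linear`). Nothing here closes the crux; everything is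
`sorry`-free over the companions' definitions.

`DriftFamily q s δ k a₁` (at every near-extremal spin and every small amplitude `ε` a vacuum datum
with `dist < ε` all of whose Kerr–Schild `Cᵏ`-limits have `|M' − M| + |a' − a| ≥ c₀ε^q`) ⇒
`captureWith_false_of_drift`: every modulus exponent `p < −(2q − 1)γ/2` is refuted (`q > 1/2`,
`γ ≥ 0`; primed version for all `γ`); `driftFamily_one_of_members` (the heavier members
`Kerr(M + η, a)` on the same slice, modulo the vacuum constraints of Kerr–Schild slice data,
`HeavierMemberDistBound` — true on paper iff `δ < −1/2` — and `HeavierMemberRigid`) ⇒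
`captureWith_false_of_members`; `modulusLine_sharp`: with a drift family of order one no
`p < −γ/2` is admissible, with a Lipschitz final-parameter map `p = −γ/2` is (landed
`captureWith_of_linear`).

DICTIONARY (`dist` is a NORM of the data difference, WeightedNorms.lean: `dist ≍ amplitude`,
radiated `(E, J) ≍ dist²`): `q = 1` wherever a Kerr parameter is unpinned (mass members for
`δ < −1/2`, spin-shifted members `Kerr(M, a + η)` on `Kerr.slice a M` for `δ < 1/2`): edge
`p = −γ/2`; `q = 2` in pinned norms `δ ≥ 1/2` (an outgoing wave packet of amplitude `ε` radiates
`E ≍ ε²` through `𝓘⁺` while `M_ADM = M` is pinned): edge `p = −3γ/2`, and a κ-uniform quadratic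
bound on radiated `(E, J)` would conversely give `p = −3γ/2` exactly as `captureWith_of_linear`
gives `−γ/2`. Reading: the exponent `p` of the typed Hölder-½ modulus `Cχ^{-p}√dist` records only
the conversion between the drift law and `√dist` at the basin scale — no κ-information lives in it.

References: Angelopoulos–Kehle–Unger arXiv:2603.10378 (Conj. 1); Bartnik, CPAM 39 (1986), (1.2)
(weighted Sobolev norms).
-/

noncomputable section

set_option linter.dupNamespace false

namespace Summit.FinalStateConjecture.FinalStateConjecture.Theorems.NearExtremalKappaCapture.Negative

open Literature.Geometry.Lorentzian
open scoped Manifold ContDiff Topology ENNReal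
open Set Filter

/-! ## §10  Drift families: the lower edge `p = −(2q − 1)γ/2` of the modulus exponent -/

/-- **`DriftFamily q s δ k a₁`** — parameter drift of order `q` in the amplitude is realised at
every small amplitude: for every `M > 0` there are `c₀ > 0`, `ε₀ > 0` such that at every spin
`a₁M ≤ |a| < M` and every `0 < ε < ε₀` some vacuum datum on `Kerr.slice a M` within `dist < ε`
of the Kerr datum has a maximal development ALL of whose Kerr–Schild `Cᵏ`-limits `(M', a')` have
`|M' − M| + |a' − a| ≥ c₀ε^q`. ON PAPER (dictionary of §9): `q = 1` whenever a Kerr parameter is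
unpinned — heavier members `Kerr(M + η, a)` for `δ < −1/2` (`driftFamily_one_of_members` below,
modulo three facts) and spin-shifted members `Kerr(M, a + η)` restricted to `Kerr.slice a M` for
`δ < 1/2` (drift `= η ≍ dist`); `q = 2` in pinned norms `δ ≥ 1/2` — an outgoing wave packet of
amplitude `≍ ε` radiates `E ≍ ε²` through `𝓘⁺` while `M_ADM = M` is pinned, so `M' = M − E`.
[folklore] -/
def DriftFamily [Kerr.Facts] [Kerr.SliceFacts] (q : ℝ) (s : ℕ) (δ : ℝ) (k : ℕ) (a₁ : ℝ) :
    Prop :=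
  ∀ (M : ℝ) (hM : 0 < M), ∃ c₀ > (0 : ℝ), ∃ ε₀ > (0 : ℝ), ∀ a : ℝ, a₁ * M ≤ |a| → |a| < M →
    ∀ ε : ℝ, 0 < ε → ε < ε₀ →
      ∃ (D : InitialDataSet 𝓘(ℝ, E3) (Kerr.slice a M)) (_ : D.metric.HasLeviCivita),
        D.IsVacuumConstraintSolution ∧
          InitialDataSet.dataWeightedSobolevEDist s δ D (Kerr.data M a M hM.le) <
              ENNReal.ofReal ε ∧
            ∃ 𝒟 : VacuumCauchyDevelopment D, 𝒟.IsMaximal ∧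
              ∀ (M' a' : ℝ) (𝒟oc : Set 𝒟.carrier),
                𝒟.toSpacetime.ConvergesToKerr 𝒟oc M' a' k → c₀ * ε ^ q ≤ |M' - M| + |a' - a|

/-- Drift of order `q` is drift of every order `q' ≥ q` (amplitudes `ε < 1`: shrink `ε₀` to
`min ε₀ 1`, then `ε^{q'} ≤ ε^q`). So the refuted corner only grows with `q`, and `q = 1` (a
parameter unpinned) is the strongest instance. -/
theorem DriftFamily.mono [Kerr.Facts] [Kerr.SliceFacts] {q q' : ℝ} {s : ℕ} {δ : ℝ} {k : ℕ}
    {a₁ : ℝ} (h : DriftFamily q s δ k a₁) (hq : q ≤ q') : DriftFamily q' s δ k a₁ := by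
  intro M hM
  obtain ⟨c₀, hc₀, ε₀, hε₀, h⟩ := h M hM
  refine ⟨c₀, hc₀, min ε₀ 1, lt_min hε₀ one_pos, fun a ha haM ε hε hεε₀ ↦ ?_⟩
  obtain ⟨D, inst, hvac, hdist, 𝒟, hmax, hdrift⟩ :=
    h a ha haM ε hε (hεε₀.trans_le (min_le_left _ _))
  refine ⟨D, inst, hvac, hdist, 𝒟, hmax,
    fun M' a' 𝒟oc hconv ↦ le_trans ?_ (hdrift M' a' 𝒟oc hconv)⟩
  have hε1 : ε ≤ 1 := (hεε₀.trans_le (min_le_right _ _)).le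
  exact mul_le_mul_of_nonneg_left (Real.rpow_le_rpow_of_exponent_ge hε hε1 hq) hc₀.le

/-- **The lower edge: a drift family of order `q > 1/2` refutes every modulus exponent
`p < −(2q − 1)γ/2`** (`γ ≥ 0`). At `M = 1`, given the constants `c, C` of `CaptureWith`, put
`n = 2q − 1`, `B = (C⁺/c₀)²` and choose `χ` so small that `2Bχ^{−2p−nγ} ≤ cⁿ/2` and
`2Bχ^{−2p} ≤ ε₀ⁿ/2` (both exponents POSITIVE iff `p < −nγ/2`, `p < 0`); at the spin
`a = √(1 − χ)` take the drifting datum of amplitude `ε = (2Bχ^{−2p})^{1/n}` (inside the basin).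
Capture gives `c₀εq ≤ C⁺χ^{−p}√ε`; squaring and dividing by `ε`, `c₀²εⁿ ≤ C⁺²χ^{−2p}`, i.e.
`2Bc₀² ≤ C⁺²` with `Bc₀² = C⁺²`: absurd. Readings: `q = 1` (a parameter unpinned) ⇒ no
`p < −γ/2`; `q = 2` (all charges pinned, quadratic radiation) ⇒ no `p < −3γ/2`. Conversely a
Lipschitz resp. quadratic final-parameter bound without κ-factor GIVES `p = −γ/2` resp. `−3γ/2`
(`captureWith_of_linear`; the quadratic case identically with `dist² ≤ cχ^γ·√c χ^{γ/2}·√dist`),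
so these edges are sharp modulo those bounds: the exponent `p` records only the conversion
between the drift law and `√dist` at the basin scale — no κ-information lives in it. -/
theorem captureWith_false_of_drift [Kerr.Facts] [Kerr.SliceFacts] {q : ℝ} {s : ℕ} {δ : ℝ}
    {k : ℕ} {γ p a₁ : ℝ} (ha₁ : a₁ < 1) (H : DriftFamily q s δ k a₁) (hq : 1 / 2 < q)
    (hγ : 0 ≤ γ) (hp : p < -((2 * q - 1) * γ / 2)) : ¬ CaptureWith s δ k γ p a₁ := by
  intro h
  obtain ⟨c, hc, C, h⟩ := h 1 one_pos
  obtain ⟨c₀, hc₀, ε₀, hε₀, H⟩ := H 1 one_pos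
  -- the drift exponent `n = 2q - 1 > 0`; `p < 0`
  set n : ℝ := 2 * q - 1 with hn
  have hn0 : 0 < n := by rw [hn]; linarith
  have hnγ : 0 ≤ n * γ := mul_nonneg hn0.le hγ
  have hp0 : p < 0 := by
    have : -((2 * q - 1) * γ / 2) ≤ 0 := by rw [← hn]; linarith
    linarith
  -- constants
  set C' : ℝ := max C 0 + 1 with hC'
  have hC'pos : 0 < C' := by positivity
  have hCC' : C ≤ C' := by simp [hC']; linarith [le_max_left C 0]
  have hc₀ne : c₀ ≠ 0 := hc₀.ne'
  set B : ℝ := (C' / c₀) ^ 2 with hB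
  have hB0 : 0 < B := by positivity
  have hBne : B ≠ 0 := hB0.ne'
  have hBc : B * c₀ ^ 2 = C' ^ 2 := by rw [hB]; field_simp
  set a₀ : ℝ := max a₁ 0 with ha₀
  have ha₀0 : 0 ≤ a₀ := le_max_right _ _
  have ha₀1 : a₀ < 1 := max_lt ha₁ one_pos
  have hx₀ : 0 < 1 - a₀ ^ 2 := by nlinarith
  -- the two positive exponents and the choice of `χ`
  set e₂ : ℝ := -2 * p with he₂
  have he₂0 : 0 < e₂ := by rw [he₂]; linarith
  set e₁ : ℝ := e₂ - n * γ with he₁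
  have he₁0 : 0 < e₁ := by
    rw [he₁, he₂]
    have : p < -(n * γ / 2) := hp
    linarith
  set q₁ : ℝ := c ^ n / (4 * B) with hq₁
  have hcn : 0 < c ^ n := Real.rpow_pos_of_pos hc _
  have hq₁0 : 0 < q₁ := by positivity
  set q₂ : ℝ := ε₀ ^ n / (4 * B) with hq₂
  have hε₀n : 0 < ε₀ ^ n := Real.rpow_pos_of_pos hε₀ _
  have hq₂0 : 0 < q₂ := by positivity
  set χ₁ : ℝ := q₁ ^ (1 / e₁) with hχ₁
  have hχ₁0 : 0 < χ₁ := Real.rpow_pos_of_pos hq₁0 _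
  set χ₂ : ℝ := q₂ ^ (1 / e₂) with hχ₂
  have hχ₂0 : 0 < χ₂ := Real.rpow_pos_of_pos hq₂0 _
  set χ : ℝ := min (min χ₁ χ₂) (1 - a₀ ^ 2) with hχdef
  have hχ0 : 0 < χ := lt_min (lt_min hχ₁0 hχ₂0) hx₀
  have hχle : χ ≤ 1 - a₀ ^ 2 := min_le_right _ _
  have hχe₁ : χ ^ e₁ ≤ q₁ := by
    calc χ ^ e₁ ≤ χ₁ ^ e₁ :=
          Real.rpow_le_rpow hχ0.le ((min_le_left _ _).trans (min_le_left _ _)) he₁0.le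
      _ = q₁ := by
          rw [hχ₁, ← Real.rpow_mul hq₁0.le, one_div_mul_cancel he₁0.ne', Real.rpow_one]
  have hχe₂ : χ ^ e₂ ≤ q₂ := by
    calc χ ^ e₂ ≤ χ₂ ^ e₂ :=
          Real.rpow_le_rpow hχ0.le ((min_le_left _ _).trans (min_le_right _ _)) he₂0.le
      _ = q₂ := by
          rw [hχ₂, ← Real.rpow_mul hq₂0.le, one_div_mul_cancel he₂0.ne', Real.rpow_one]
  -- the amplitude `ε = (2 B χ^{e₂})^{1/n}` : `ε^n = 2Bχ^{e₂}`, inside the basin and below `ε₀`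
  set T : ℝ := 2 * B * χ ^ e₂ with hT
  have hT0 : 0 < T := by positivity
  set ε : ℝ := T ^ (1 / n) with hεdef
  have hε0 : 0 < ε := Real.rpow_pos_of_pos hT0 _
  have hεn : ε ^ n = T := by
    rw [hεdef, ← Real.rpow_mul hT0.le, one_div_mul_cancel hn0.ne', Real.rpow_one]
  have hχγ0 : 0 < χ ^ γ := Real.rpow_pos_of_pos hχ0 _
  have hsplit : χ ^ e₂ = χ ^ e₁ * χ ^ (n * γ) := by
    rw [← Real.rpow_add hχ0, he₁, sub_add_cancel]
  have hcχn : (c * χ ^ γ) ^ n = c ^ n * χ ^ (n * γ) := by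
    rw [Real.mul_rpow hc.le hχγ0.le, ← Real.rpow_mul hχ0.le, mul_comm γ n]
  have hεbasin : ε < c * χ ^ γ := by
    rw [← Real.rpow_lt_rpow_iff hε0.le (by positivity) hn0, hεn, hcχn]
    calc T = 2 * B * χ ^ e₁ * χ ^ (n * γ) := by rw [hT, hsplit]; ring
      _ ≤ 2 * B * q₁ * χ ^ (n * γ) :=
          mul_le_mul_of_nonneg_right (mul_le_mul_of_nonneg_left hχe₁ (by positivity))
            (Real.rpow_nonneg hχ0.le _)
      _ = (c ^ n / 2) * χ ^ (n * γ) := by rw [hq₁]; field_simp; ring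
      _ < c ^ n * χ ^ (n * γ) := by
          have : 0 < χ ^ (n * γ) := Real.rpow_pos_of_pos hχ0 _
          nlinarith
  have hεε₀ : ε < ε₀ := by
    rw [← Real.rpow_lt_rpow_iff hε0.le hε₀.le hn0, hεn]
    calc T = 2 * B * χ ^ e₂ := rfl
      _ ≤ 2 * B * q₂ := mul_le_mul_of_nonneg_left hχe₂ (by positivity)
      _ = ε₀ ^ n / 2 := by rw [hq₂]; field_simp; ring
      _ < ε₀ ^ n := by linarith
  -- the spin and the drifting datum
  obtain ⟨ha₀a, ha1, haχ⟩ := spin_of_kappaSq hχ0 ha₀0 hχle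
  set a : ℝ := √(1 - χ) with ha_def
  have ha0 : 0 ≤ a := Real.sqrt_nonneg _
  have habs : |a| = a := abs_of_nonneg ha0
  have ha₁a : a₁ * 1 ≤ |a| := by rw [mul_one, habs]; exact (le_max_left _ _).trans ha₀a
  have hsub : Kerr.IsSubextremal 1 a := by show |a| < 1; rwa [habs]
  have hχa : 1 - (a / 1) ^ 2 = χ := by rw [div_one]; exact haχ
  obtain ⟨D, inst, hvacD, hdist, 𝒟, hmax, hdrift⟩ := H a ha₁a (by rwa [habs]) ε hε0 hεε₀
  haveI := inst
  have hbasin : InitialDataSet.dataWeightedSobolevEDist s δ D (Kerr.data 1 a 1 one_pos.le) <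
      ENNReal.ofReal (c * (1 - (a / 1) ^ 2) ^ γ) := by
    rw [hχa]
    exact hdist.trans_le (ENNReal.ofReal_le_ofReal hεbasin.le)
  obtain ⟨M', a', 𝒟oc, -, -, hconv, hmod⟩ := h a ha₁a hsub D hvacD hbasin 𝒟 hmax
  have hdr := hdrift M' a' 𝒟oc hconv
  -- `c₀ ε^q ≤ |M' - 1| + |a' - a| ≤ C' χ^{-p} √ε`
  set d : ℝ := (InitialDataSet.dataWeightedSobolevEDist s δ D (Kerr.data 1 a 1 one_pos.le)).toReal
    with hddef
  have hd0 : 0 ≤ d := ENNReal.toReal_nonneg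
  have hdε : d < ε := ENNReal.toReal_lt_of_lt_ofReal hdist
  have hxp0 : 0 < χ ^ (-p) := Real.rpow_pos_of_pos hχ0 _
  have hchain : c₀ * ε ^ q ≤ C' * χ ^ (-p) * √ε := by
    calc c₀ * ε ^ q ≤ |M' - 1| + |a' - a| := hdr
      _ ≤ C * (1 - (a / 1) ^ 2) ^ (-p) * √d := hmod
      _ = C * χ ^ (-p) * √d := by rw [hχa]
      _ ≤ C' * χ ^ (-p) * √d :=
          mul_le_mul_of_nonneg_right (mul_le_mul_of_nonneg_right hCC' hxp0.le) (Real.sqrt_nonneg _)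
      _ ≤ C' * χ ^ (-p) * √ε :=
          mul_le_mul_of_nonneg_left (Real.sqrt_le_sqrt hdε.le) (by positivity)
  -- square: `c₀² ε^{2q} ≤ C'² χ^{e₂} ε`, with `ε^{2q} = ε^n ε` and `(χ^{-p})² = χ^{e₂}`
  have hεq0 : 0 ≤ ε ^ q := Real.rpow_nonneg hε0.le _
  have hsq : (c₀ * ε ^ q) ^ 2 ≤ (C' * χ ^ (-p) * √ε) ^ 2 :=
    pow_le_pow_left₀ (by positivity) hchain 2
  have hxsq : (χ ^ (-p)) ^ 2 = χ ^ e₂ := by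
    rw [pow_two, ← Real.rpow_add hχ0, he₂]
    congr 1
    ring
  have hεsq : (√ε) ^ 2 = ε := Real.sq_sqrt hε0.le
  have hε2q : (ε ^ q) ^ 2 = ε ^ n * ε := by
    rw [pow_two, ← Real.rpow_add hε0, ← Real.rpow_add_one hε0.ne', hn]
    congr 1
    ring
  have key : c₀ ^ 2 * (ε ^ n * ε) ≤ C' ^ 2 * χ ^ e₂ * ε := by
    have h1 : (c₀ * ε ^ q) ^ 2 = c₀ ^ 2 * (ε ^ q) ^ 2 := by ring
    have h2 : (C' * χ ^ (-p) * √ε) ^ 2 = C' ^ 2 * (χ ^ (-p)) ^ 2 * (√ε) ^ 2 := by ring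
    rw [h1, h2, hε2q, hxsq, hεsq] at hsq
    exact hsq
  -- divide by `ε > 0` and substitute `ε^n = 2Bχ^{e₂}`, `B c₀² = C'²`
  have key' : c₀ ^ 2 * ε ^ n ≤ C' ^ 2 * χ ^ e₂ := by
    refine le_of_mul_le_mul_right ?_ hε0
    calc c₀ ^ 2 * ε ^ n * ε = c₀ ^ 2 * (ε ^ n * ε) := by ring
      _ ≤ C' ^ 2 * χ ^ e₂ * ε := key
  have hχe₂0 : 0 < χ ^ e₂ := Real.rpow_pos_of_pos hχ0 _
  have h2 : 2 * (C' ^ 2 * χ ^ e₂) ≤ C' ^ 2 * χ ^ e₂ := by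
    calc 2 * (C' ^ 2 * χ ^ e₂) = (B * c₀ ^ 2) * (2 * χ ^ e₂) := by rw [hBc]; ring
      _ = c₀ ^ 2 * (2 * B * χ ^ e₂) := by ring
      _ = c₀ ^ 2 * ε ^ n := by rw [hεn, hT]
      _ ≤ C' ^ 2 * χ ^ e₂ := key'
  have hpos : 0 < C' ^ 2 * χ ^ e₂ := mul_pos (pow_pos hC'pos 2) hχe₂0
  linarith

/-- The same for an arbitrary basin exponent: every `p < −(2q − 1)·max γ 0/2` is refuted (raise
`γ` to `max γ 0` by `captureWith_mono` first). -/
theorem captureWith_false_of_drift' [Kerr.Facts] [Kerr.SliceFacts] {q : ℝ} {s : ℕ} {δ : ℝ}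
    {k : ℕ} {γ p a₁ : ℝ} (ha₁ : a₁ < 1) (H : DriftFamily q s δ k a₁) (hq : 1 / 2 < q)
    (hp : p < -((2 * q - 1) * max γ 0 / 2)) :
    ¬ CaptureWith s δ k γ p a₁ :=
  fun h ↦ captureWith_false_of_drift ha₁ H hq (le_max_right _ _) hp
    (captureWith_mono h le_rfl le_rfl le_rfl (le_max_left _ _) le_rfl le_rfl)

/-- **The modulus line `p = −γ/2` is sharp where a parameter is unpinned** (modulo the two paper
inputs): granted a drift family of order one, no `p < −γ/2` is admissible at basin exponent
`γ ≥ 0`; granted a Lipschitz final-parameter map on the basin `cχ^γ` (`LinearCaptureWith` —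
what AKU's foliation picture gives in a topology in which the Kerr family is continuous, i.e.
`δ < 1/2`), `p = −γ/2` IS admissible (landed `captureWith_of_linear`). -/
theorem modulusLine_sharp [Kerr.Facts] [Kerr.SliceFacts] {s : ℕ} {δ : ℝ} {k : ℕ} {γ a₁ : ℝ}
    (ha₁ : a₁ < 1) (hγ : 0 ≤ γ) (H : DriftFamily 1 s δ k a₁) :
    (∀ p : ℝ, p < -(γ / 2) → ¬ CaptureWith s δ k γ p a₁) ∧
      (LinearCaptureWith s δ k γ a₁ → CaptureWith s δ k γ (-(γ / 2)) a₁) :=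
  ⟨fun _ hp ↦ captureWith_false_of_drift ha₁ H (by norm_num) hγ (by linarith),
    captureWith_of_linear⟩

/-- **H_dist⁺(s, δ, a₁)** — distance of the heavier members: for every `M > 0` there are `K` and
`η₀ > 0` with `dist_{s,δ}(Kerr.data (M + η) a M, Kerr.data M a M) ≤ Kη` for all spins
`a₁M ≤ |a| < M` and all `0 < η < η₀`. TRUE on paper iff `δ < −1/2` (the Kerr–Schild form is affine
in the mass at fixed `a`; `‖(1 + |y|)^δ r⁻¹‖_{L²} < ∞` iff `δ < −1/2`), `dist = ⊤` otherwise.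
Bartnik, CPAM 39 (1986), (1.2). [folklore] -/
def HeavierMemberDistBound [Kerr.Facts] [Kerr.SliceFacts] (s : ℕ) (δ a₁ : ℝ) : Prop :=
  ∀ (M : ℝ) (hM : 0 < M), ∃ K : ℝ, ∃ η₀ > (0 : ℝ), ∀ (a η : ℝ), a₁ * M ≤ |a| → |a| < M →
    (hη : 0 < η) → η < η₀ →
      InitialDataSet.dataWeightedSobolevEDist s δ
          (Kerr.data (M + η) a M (by linarith)) (Kerr.data M a M hM.le) ≤
        ENNReal.ofReal (K * η)

/-- **H_rig(k, a₁)** — rigidity of the heavier members' developments: for `a₁M ≤ |a| < M` and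
`η > 0` the datum `Kerr.data (M + η) a M` has a maximal vacuum Cauchy development (Choquet-Bruhat–
Geroch) all of whose Kerr–Schild `Cᵏ`-limits have mass `M' = M + η` (the Kerr–Schild radius
depends on `a` only, so the edge `{r = M}` stays inside the bigger horizon; the MGHD contains the
whole future exterior of `Kerr(M + η, a)`, which is `Cᵏ`-close on late slabs to no Kerr metric of
another mass: codimension-0 `C⁰` rigidity of the Kerr family in the mass). [folklore] -/
def HeavierMemberRigid [Kerr.Facts] [Kerr.SliceFacts] (k : ℕ) (a₁ : ℝ) : Prop :=
  ∀ (M : ℝ) (_ : 0 < M) (a η : ℝ), a₁ * M ≤ |a| → |a| < M → (hη : 0 < η) →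
    ∃ (_ : (Kerr.data (M + η) a M (by linarith)).metric.HasLeviCivita)
      (𝒟 : VacuumCauchyDevelopment (Kerr.data (M + η) a M (by linarith))),
      𝒟.IsMaximal ∧ ∀ (M' a' : ℝ) (𝒟oc : Set 𝒟.carrier),
        𝒟.toSpacetime.ConvergesToKerr 𝒟oc M' a' k → M' = M + η

/-- **The heavier members are a drift family of order one** (modulo the vacuum constraints of
Kerr–Schild slice data — named fact `Kerr.data_isVacuumConstraintSolution`, a tree theorem for
`a = 0` only — `H_dist⁺` and `H_rig`): with `K' = max K 0 + 1`, `c₀ = 1/(2K')`, `ε₀ = K'η₀`, at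
amplitude `ε` take `η = ε/(2K')`; then `dist ≤ Kη ≤ ε/2 < ε` and every limit has
`|M' − M| = η = c₀ε`. Exactly parallel to `truncationTrap_one_of_lighterMembers` (§6). -/
theorem driftFamily_one_of_members [Kerr.Facts] [Kerr.SliceFacts] {s : ℕ} {δ : ℝ} {k : ℕ}
    {a₁ : ℝ} (hvac : ∀ m a r₀ : ℝ, Kerr.data_isVacuumConstraintSolution m a r₀)
    (hdist : HeavierMemberDistBound s δ a₁) (hrig : HeavierMemberRigid k a₁) :
    DriftFamily 1 s δ k a₁ := by
  intro M hM
  obtain ⟨K, η₀, hη₀, hK⟩ := hdist M hM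
  set K' : ℝ := max K 0 + 1 with hK'
  have hK'pos : 0 < K' := by positivity
  have hKK' : K ≤ K' := by simp [hK']; linarith [le_max_left K 0]
  refine ⟨1 / (2 * K'), by positivity, K' * η₀, by positivity, fun a ha haM ε hε hεε₀ ↦ ?_⟩
  set η : ℝ := ε / (2 * K') with hηdef
  have hη : 0 < η := by positivity
  have hηη₀ : η < η₀ := by
    rw [hηdef, div_lt_iff₀ (by positivity)]
    calc ε < K' * η₀ := hεε₀
      _ ≤ η₀ * (2 * K') := by nlinarith [mul_pos hK'pos hη₀]
  have hpos : 0 ≤ M + η := by linarith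
  obtain ⟨inst, 𝒟, hmax, hlim⟩ := hrig M hM a η ha haM hη
  haveI := inst
  refine ⟨Kerr.data (M + η) a M hpos, inst, hvac (M + η) a M hpos, ?_, 𝒟, hmax, ?_⟩
  · refine (hK a η ha haM hη hηη₀).trans_lt ((ENNReal.ofReal_lt_ofReal_iff hε).mpr ?_)
    calc K * η ≤ K' * η := mul_le_mul_of_nonneg_right hKK' hη.le
      _ = ε / 2 := by rw [hηdef]; field_simp
      _ < ε := by linarith
  · intro M' a' 𝒟oc hconv
    rw [hlim M' a' 𝒟oc hconv, Real.rpow_one]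
    have : |M + η - M| = η := by rw [add_sub_cancel_left, abs_of_pos hη]
    rw [this, hηdef]
    calc 1 / (2 * K') * ε = ε / (2 * K') := by ring
      _ ≤ ε / (2 * K') + |a' - a| := le_add_of_nonneg_right (abs_nonneg _)

/-- **The corner `p < −γ/2` is false modulo three Kerr facts** (`δ < −1/2` on paper): granted the
vacuum constraints of Kerr–Schild slice data, `H_dist⁺(s, δ, a₁)` and `H_rig(k, a₁)`, capture
with `p < −max γ 0 / 2` FAILS. -/
theorem captureWith_false_of_members [Kerr.Facts] [Kerr.SliceFacts] {s : ℕ} {δ : ℝ} {k : ℕ}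
    {γ p a₁ : ℝ} (ha₁ : a₁ < 1)
    (hvac : ∀ m a r₀ : ℝ, Kerr.data_isVacuumConstraintSolution m a r₀)
    (hdist : HeavierMemberDistBound s δ a₁) (hrig : HeavierMemberRigid k a₁)
    (hp : p < -(max γ 0 / 2)) : ¬ CaptureWith s δ k γ p a₁ :=
  captureWith_false_of_drift' ha₁ (driftFamily_one_of_members hvac hdist hrig) (by norm_num)
    (by linarith)

end Summit.FinalStateConjecture.FinalStateConjecture.Theorems.NearExtremalKappaCapture.Negative

end
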